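import Summits.Ventures.PercRepro.Night2LocalD2R14SixZeroE

/-!
# PercRepro — the six-element columns of R1₄ without a far preimage, part F: the linear spread accounting
(night-2, gen 16)

For a layer-0 basis `B` (`|B| = 4`) write `faceW B z' = (r14Cov (face) − 4/25)⁺` when the face `(B ∖ z') ∪ (G ∖ cl B)` is a
member and `0` otherwise.  Then `(σ⁺(B) − 3/5)⁺ ≤ 1/25 + Σ_{z' ∈ B} faceW B z'` (`max_sigma_sub_le`), each
`faceW ≤ 2/175` (`faceW_le`) and `faceW = 0` unless the face has `|G ∖ cl| ≥ 5` (`faceW_eq_zero_of_le_four`).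
Hence the spread part at `|S| = 6` is at most `Σ_{B ∈ 𝓑} (1/25 + Σ_{z' ∈ B} faceW B z') / (|G ∖ S| + 1)` over the
spreading bases `𝓑` (`r14Spread_le_six'`), the refinement of `r14Spread_le_six` used for the cells `κ ≤ 1`
(proofs/NIGHT-2-k1.md §7.4).
-/

namespace PercRepro.Shadow

open Finset PerFlat ThmH

variable {α : Type*} [DecidableEq α] {M : Matroid α} [M.Finite]

open scoped Classical in
/-- `(σ⁺(B) − 3/5)⁺ ≤ 1/25 + Σ_{z' ∈ B} faceW B z'` for `|B| = 4`. -/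
theorem max_sigma_sub_le {G B : Finset α} (hB4 : B.card = 4) :
    max 0 (r14Sigma M G B - 3 / 5) ≤ 1 / 25 + ∑ z' ∈ B,
      (if (B.erase z') ∪ (G \ clF M B) ∈ membersIn M (Uq M (4 + 2) 4) G then
        max 0 (r14Cov M G ((B.erase z') ∪ (G \ clF M B)) - 4 / 25) else 0) := by
  have hterm : ∀ z' ∈ B, (if (B.erase z') ∪ (G \ clF M B) ∈ membersIn M (Uq M (4 + 2) 4) G then
      r14Cov M G ((B.erase z') ∪ (G \ clF M B)) else 0) ≤ 4 / 25 +
      (if (B.erase z') ∪ (G \ clF M B) ∈ membersIn M (Uq M (4 + 2) 4) G then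
        max 0 (r14Cov M G ((B.erase z') ∪ (G \ clF M B)) - 4 / 25) else 0) := by
    intro z' _
    split_ifs
    · have := le_max_right (0 : ℚ) (r14Cov M G ((B.erase z') ∪ (G \ clF M B)) - 4 / 25)
      linarith
    · norm_num
  have hsum : r14Sigma M G B ≤ 16 / 25 + ∑ z' ∈ B,
      (if (B.erase z') ∪ (G \ clF M B) ∈ membersIn M (Uq M (4 + 2) 4) G then
        max 0 (r14Cov M G ((B.erase z') ∪ (G \ clF M B)) - 4 / 25) else 0) := by
    unfold r14Sigma
    calc ∑ z' ∈ B, (if (B.erase z') ∪ (G \ clF M B) ∈ membersIn M (Uq M (4 + 2) 4) G then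
          r14Cov M G ((B.erase z') ∪ (G \ clF M B)) else 0)
        ≤ ∑ z' ∈ B, (4 / 25 + (if (B.erase z') ∪ (G \ clF M B) ∈ membersIn M (Uq M (4 + 2) 4) G then
          max 0 (r14Cov M G ((B.erase z') ∪ (G \ clF M B)) - 4 / 25) else 0)) := Finset.sum_le_sum hterm
      _ = 16 / 25 + ∑ z' ∈ B, (if (B.erase z') ∪ (G \ clF M B) ∈ membersIn M (Uq M (4 + 2) 4) G then
          max 0 (r14Cov M G ((B.erase z') ∪ (G \ clF M B)) - 4 / 25) else 0) := by
          rw [Finset.sum_add_distrib, Finset.sum_const, hB4, nsmul_eq_mul]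
          norm_num
  have hnn : 0 ≤ ∑ z' ∈ B, (if (B.erase z') ∪ (G \ clF M B) ∈ membersIn M (Uq M (4 + 2) 4) G then
      max 0 (r14Cov M G ((B.erase z') ∪ (G \ clF M B)) - 4 / 25) else 0) := by
    apply Finset.sum_nonneg
    intro z' _
    split_ifs
    · exact le_max_left _ _
    · exact le_refl _
  apply max_le
  · linarith
  · linarith

/-- `(r14Cov F − 4/25)⁺ ≤ 2/175`. -/
theorem faceW_le (G F : Finset α) : max 0 (r14Cov M G F - 4 / 25) ≤ 2 / 175 := by
  have := r14Cov_le (M := M) G F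
  apply max_le (by norm_num)
  linarith

/-- `(r14Cov F − 4/25)⁺ = 0` when `|G ∖ cl F| ≤ 4`. -/
theorem faceW_eq_zero_of_le_four {G F : Finset α} (h : (G \ clF M F).card ≤ 4) :
    max 0 (r14Cov M G F - 4 / 25) = 0 := by
  unfold r14Cov
  rw [if_pos h]
  norm_num

open scoped Classical in
/-- **The refined spread bound at `|S| = 6`**: the spread part is at most the sum over the spreading bases `B`
(members with `|G ∖ cl B| = 1`, `|B| = 4`, `S = insert x (B ∪ {y})`) of `(1/25 + Σ_{z' ∈ B} faceW B z')/(|G ∖ S| + 1)`. -/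
theorem r14Spread_le_six' {G : Finset α} (hG : G ∈ flatsQ M (4 + 1)) {y : α} (hyG : y ∈ G)
    (hyc : y ∉ clF M (G.erase y)) (hP : ∀ z ∈ G.erase y, 4 ≤ rkN M ((G.erase y).erase z)) {S : Finset α}
    (hS : S ∈ shadowAt M (4 + 2) 4 (Uq M (4 + 2) 4) G) (h6 : S.card = 6) :
    r14Spread M G S ≤ ∑ B ∈ ((membersIn M (Uq M (4 + 2) 4) G).filter (fun B => (G \ clF M B).card = 1 ∧ ¬ 5 ≤ B.card)).filter
        (fun B => ∃ x ∈ S, S = insert x (B ∪ (G \ clF M B))),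
      (1 / 25 + ∑ z' ∈ B, (if (B.erase z') ∪ (G \ clF M B) ∈ membersIn M (Uq M (4 + 2) 4) G then
        max 0 (r14Cov M G ((B.erase z') ∪ (G \ clF M B)) - 4 / 25) else 0)) / (((G \ S).card : ℚ) + 1) := by
  have hSG : S ⊆ G := subset_of_mem_shadowAt hS
  set q : ℚ := ((G \ S).card : ℚ) with hqdef
  have hq1 : (0 : ℚ) < q + 1 := by positivity
  -- the per-basis constant
  set cB : Finset α → ℚ := fun B => (1 / 25 + ∑ z' ∈ B,
    (if (B.erase z') ∪ (G \ clF M B) ∈ membersIn M (Uq M (4 + 2) 4) G then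
      max 0 (r14Cov M G ((B.erase z') ∪ (G \ clF M B)) - 4 / 25) else 0)) / (q + 1) with hcBdef
  have hcB0 : ∀ B, 0 ≤ cB B := by
    intro B
    apply div_nonneg _ hq1.le
    apply add_nonneg (by norm_num)
    apply Finset.sum_nonneg
    intro z' _
    split_ifs
    · exact le_max_left _ _
    · exact le_refl _
  have hterm : ∀ B ∈ (membersIn M (Uq M (4 + 2) 4) G).filter (fun B => (G \ clF M B).card = 1 ∧ ¬ 5 ≤ B.card),
      ∑ x ∈ clF M B \ B, (if S = insert x (B ∪ (G \ clF M B)) then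
        (2 / 5 - r14Keep M G B) / ((clF M B \ B).card : ℚ) else 0) ≤
      (if ∃ x ∈ S, S = insert x (B ∪ (G \ clF M B)) then cB B else 0) := by
    intro B hB
    rw [Finset.mem_filter] at hB
    obtain ⟨hBm, hm1, hB5⟩ := hB
    have hpt : ∀ x ∈ clF M B \ B, (if S = insert x (B ∪ (G \ clF M B)) then
        (2 / 5 - r14Keep M G B) / ((clF M B \ B).card : ℚ) else 0) ≤
        (if x ∈ S ∧ S = insert x (B ∪ (G \ clF M B)) then cB B else 0) := by
      intro x hx
      by_cases hSx : S = insert x (B ∪ (G \ clF M B))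
      · obtain ⟨hGy, hyB, hxB, hxy, hB4, hSx'⟩ := basis_facts_of_six hG hyG hyc hP h6 hBm hm1 hx hSx
        have hxS : x ∈ S := by rw [hSx']; exact Finset.mem_insert_self _ _
        rw [if_pos hSx, if_pos ⟨hxS, hSx⟩]
        have hk := two_fifths_sub_r14Keep_le (M := M) G B
        have hs := max_sigma_sub_le (M := M) (G := G) hB4
        have hcard := card_sdiff_ge_of_basis hG hyG hyc hSG hBm hxB hxy hyB hSx'
        have hcpos : (0 : ℚ) < ((clF M B \ B).card : ℚ) := by
          have : 0 < (clF M B \ B).card := by omega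
          exact_mod_cast this
        have hnum0 : 0 ≤ 2 / 5 - r14Keep M G B := by linarith [r14Keep_le (M := M) G B]
        have hcq : q + 1 ≤ ((clF M B \ B).card : ℚ) := by rw [hqdef]; exact_mod_cast hcard
        rw [hcBdef]
        show (2 / 5 - r14Keep M G B) / ((clF M B \ B).card : ℚ) ≤ (1 / 25 + ∑ z' ∈ B,
          (if (B.erase z') ∪ (G \ clF M B) ∈ membersIn M (Uq M (4 + 2) 4) G then
            max 0 (r14Cov M G ((B.erase z') ∪ (G \ clF M B)) - 4 / 25) else 0)) / (q + 1)
        calc (2 / 5 - r14Keep M G B) / ((clF M B \ B).card : ℚ)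
            ≤ (2 / 5 - r14Keep M G B) / (q + 1) := div_le_div_of_nonneg_left hnum0 hq1 hcq
          _ ≤ (1 / 25 + ∑ z' ∈ B, (if (B.erase z') ∪ (G \ clF M B) ∈ membersIn M (Uq M (4 + 2) 4) G then
              max 0 (r14Cov M G ((B.erase z') ∪ (G \ clF M B)) - 4 / 25) else 0)) / (q + 1) := by
              apply div_le_div_of_nonneg_right _ hq1.le
              linarith
      · rw [if_neg hSx, if_neg (fun h => hSx h.2)]
    calc ∑ x ∈ clF M B \ B, (if S = insert x (B ∪ (G \ clF M B)) then
          (2 / 5 - r14Keep M G B) / ((clF M B \ B).card : ℚ) else 0)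
        ≤ ∑ x ∈ clF M B \ B, (if x ∈ S ∧ S = insert x (B ∪ (G \ clF M B)) then cB B else 0) :=
          Finset.sum_le_sum hpt
      _ ≤ (if ∃ x ∈ S, S = insert x (B ∪ (G \ clF M B)) then cB B else 0) := by
          rw [← Finset.sum_filter]
          have hle : ((clF M B \ B).filter (fun x => x ∈ S ∧ S = insert x (B ∪ (G \ clF M B)))).card ≤ 1 := by
            rw [Finset.card_le_one]
            intro x hx x' hx'
            rw [Finset.mem_filter] at hx hx'
            have h2 : x' ∈ insert x (B ∪ (G \ clF M B)) := by rw [← hx.2.2, hx'.2.2]; exact Finset.mem_insert_self _ _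
            rw [Finset.mem_insert] at h2
            rcases h2 with h | h
            · exact h.symm
            · exfalso
              rw [Finset.mem_union] at h
              rcases h with h | h
              · exact (Finset.mem_sdiff.1 hx'.1).2 h
              · exact (Finset.mem_sdiff.1 h).2 (Finset.mem_sdiff.1 hx'.1).1
          rw [Finset.sum_const, nsmul_eq_mul]
          split_ifs with hex
          · have : (((clF M B \ B).filter (fun x => x ∈ S ∧ S = insert x (B ∪ (G \ clF M B)))).card : ℚ) ≤ 1 := by
              exact_mod_cast hle
            have := hcB0 B
            nlinarith
          · have hempty : (clF M B \ B).filter (fun x => x ∈ S ∧ S = insert x (B ∪ (G \ clF M B))) = ∅ := by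
              rw [Finset.filter_eq_empty_iff]
              intro x _ hx
              exact hex ⟨x, hx.1, hx.2⟩
            rw [hempty, Finset.card_empty]
            simp
  unfold r14Spread
  calc ∑ B ∈ (membersIn M (Uq M (4 + 2) 4) G).filter (fun B => (G \ clF M B).card = 1 ∧ ¬ 5 ≤ B.card),
        ∑ x ∈ clF M B \ B, (if S = insert x (B ∪ (G \ clF M B)) then
          (2 / 5 - r14Keep M G B) / ((clF M B \ B).card : ℚ) else 0)
      ≤ ∑ B ∈ (membersIn M (Uq M (4 + 2) 4) G).filter (fun B => (G \ clF M B).card = 1 ∧ ¬ 5 ≤ B.card),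
        (if ∃ x ∈ S, S = insert x (B ∪ (G \ clF M B)) then cB B else 0) := Finset.sum_le_sum hterm
    _ = ∑ B ∈ ((membersIn M (Uq M (4 + 2) 4) G).filter (fun B => (G \ clF M B).card = 1 ∧ ¬ 5 ≤ B.card)).filter
        (fun B => ∃ x ∈ S, S = insert x (B ∪ (G \ clF M B))), cB B := (Finset.sum_filter _ _).symm

end PercRepro.Shadow
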